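import Summits.HubbardSuperconductivity.HubbardSuperconductivity.Theorems.DeformationLadderApproximatingHamiltonianGCSourcedCut
import Literature.MathematicalPhysics.QuantumLattice.FermionRelabelling
import Summits.HubbardSuperconductivity.HubbardSuperconductivity.Theorems.WeakCouplingBCSWcbcsBcsConstructionBoxTilingRectangles
import Summits.HubbardSuperconductivity.HubbardSuperconductivity.Theorems.ThermalWedgeTwSourcedInertnessReduction

/-!
# Route `DeformationLadder`, item `ApproximatingHamiltonianGC` (stmt-HubbardSuperconductivity-1895):
# pair-sourced Hubbard Hamiltonians — relabelling invariance, vacuum and volume bounds, the `d`-wave weight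

Support file (`--supports stmt-HubbardSuperconductivity-1895`), continuing `…SourcedCut.lean`. For the
pair-sourced Hubbard Hamiltonians `H_{G,W} = hamiltonianWith G t U μ − Σ_{p,q} W(p,q)(b_{pq} + b_{pq}ᴴ)`:

* `dlsb_groundEnergy_sourced_eq_of_iso`: invariance of the ground energy under graph isomorphisms
  transporting the weight (the tree's `relabel`, an algebra equivalence, preserves spectra);
* `dlsb_groundEnergy_sourced_nonpos` (vacuum trial state), `dlsb_neg_le_groundEnergy_sourced`
  (volume lower bound on graphs of bounded degree with a weight supported on bonds);
* the `d`-wave weight of a coordinate map `ι : Λ → ℤ²`, `W_h(p,q) = h·d(ι q − ι p)/√2`: `|W_h| ≤ |h|`,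
  supported on nearest-neighbour pairs of the pulled-back graph (`|d| ≤ 1` is the tree's
  `abs_dWaveFormFactor_le_one`).

Ruelle, *Statistical Mechanics: Rigorous Results* (1969) §2.2, for lattice fermions with a pair source.
No definitions are introduced.
-/

set_option linter.dupNamespace false

noncomputable section

namespace Summit.HubbardSuperconductivity.HubbardSuperconductivity.Theorems

open Matrix Finset Literature.MathematicalPhysics.QuantumLattice
open Literature.MathematicalPhysics.QuantumLattice.ThermodynamicLimit
open Literature.Barriers.HubbardSuperconductivity (bondPair bondPair_conjTranspose norm_bondPair_le_two)
open scoped ComplexOrder Matrix.Norms.L2Operator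

/-! ### Relabelling invariance, vacuum bound, volume lower bound for pair-sourced Hamiltonians -/

open Literature.Probability.LatticeModels

section GenericBoxes

variable {Λ Λ' : Type*} [LinearOrder Λ] [Fintype Λ] [LinearOrder Λ'] [Fintype Λ']

/-- Bond pairs are covariant under site bijections: `Γ_f b_{pq} Γ_f⁻¹ = b_{f p, f q}`. [folklore] -/
theorem dlsb_relabel_bondPair (f : Λ ≃ Λ') (p q : Λ) :
    relabel (Orb.mapEquiv f) (bondPair p q) = bondPair (f p) (f q) := by
  simp only [bondPair, map_sub, map_mul, relabel_annihilation, Orb.mapEquiv_orb]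

/-- The pair source is covariant under site bijections transporting the weight. [folklore] -/
theorem dlsb_relabel_source (f : Λ ≃ Λ') (W : Λ → Λ → ℝ) (W' : Λ' → Λ' → ℝ)
    (hW : ∀ p q, W' (f p) (f q) = W p q) :
    relabel (Orb.mapEquiv f) (∑ p : Λ, ∑ q : Λ, ((W p q : ℝ) : ℂ) • (bondPair p q + (bondPair p q)ᴴ)) =
      ∑ p' : Λ', ∑ q' : Λ', ((W' p' q' : ℝ) : ℂ) • (bondPair p' q' + (bondPair p' q')ᴴ) := by
  rw [map_sum, ← Equiv.sum_comp f (fun p' : Λ' =>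
    ∑ q' : Λ', ((W' p' q' : ℝ) : ℂ) • (bondPair p' q' + (bondPair p' q')ᴴ))]
  refine Finset.sum_congr rfl fun p _ => ?_
  rw [map_sum, ← Equiv.sum_comp f (fun q' : Λ' =>
    ((W' (f p) q' : ℝ) : ℂ) • (bondPair (f p) q' + (bondPair (f p) q')ᴴ))]
  refine Finset.sum_congr rfl fun q _ => ?_
  rw [map_smul, map_add, relabel_conjTranspose, dlsb_relabel_bondPair, hW]

/-- **Invariance of the ground energy of a pair-sourced Hubbard Hamiltonian under graph
isomorphisms transporting the pair weight** (`relabel` is an algebra equivalence and preserves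
spectra). [folklore] -/
theorem dlsb_groundEnergy_sourced_eq_of_iso (G : SimpleGraph Λ) [DecidableRel G.Adj]
    (G' : SimpleGraph Λ') [DecidableRel G'.Adj] (f : Λ ≃ Λ')
    (hG : ∀ x y, G'.Adj (f x) (f y) ↔ G.Adj x y) (W : Λ → Λ → ℝ) (W' : Λ' → Λ' → ℝ)
    (hW : ∀ p q, W' (f p) (f q) = W p q) (t U μ : ℝ) :
    (hamiltonianWith G' t U μ -
        ∑ p : Λ', ∑ q : Λ', ((W' p q : ℝ) : ℂ) • (bondPair p q + (bondPair p q)ᴴ)).groundEnergy =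
      (hamiltonianWith G t U μ -
        ∑ p : Λ, ∑ q : Λ, ((W p q : ℝ) : ℂ) • (bondPair p q + (bondPair p q)ᴴ)).groundEnergy := by
  have hrel : relabel (Orb.mapEquiv f) (hamiltonianWith G t U μ -
      ∑ p : Λ, ∑ q : Λ, ((W p q : ℝ) : ℂ) • (bondPair p q + (bondPair p q)ᴴ)) =
      hamiltonianWith G' t U μ -
        ∑ p : Λ', ∑ q : Λ', ((W' p q : ℝ) : ℂ) • (bondPair p q + (bondPair p q)ᴴ) := by
    rw [map_sub, relabel_hamiltonianWith G G' f hG, dlsb_relabel_source f W W' hW]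
  rw [← hrel]
  unfold Matrix.groundEnergy ContinuousLinearMap.groundEnergy
  rw [Matrix.spectrum_toEuclideanCLM, Matrix.spectrum_toEuclideanCLM, AlgEquiv.spectrum_eq]

/-- **The ground energy of a pair-sourced Hubbard Hamiltonian is non-positive**: the vacuum is a
unit trial vector annihilated by `hamiltonianWith` and by every `b_{pq}`. [folklore] -/
theorem dlsb_groundEnergy_sourced_nonpos (G : SimpleGraph Λ) [DecidableRel G.Adj] (W : Λ → Λ → ℝ)
    (t U μ : ℝ) :
    (hamiltonianWith G t U μ -
        ∑ p : Λ, ∑ q : Λ, ((W p q : ℝ) : ℂ) • (bondPair p q + (bondPair p q)ᴴ)).groundEnergy ≤ 0 := by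
  have h1 : star (vacuum : Fock (Orb Λ)) ⬝ᵥ (vacuum : Fock (Orb Λ)) = 1 := by
    simp [vacuum]
  have hB : ∀ p q : Λ, bondPair p q *ᵥ (vacuum : Fock (Orb Λ)) = 0 := fun p q => by
    have hv := annihilation_mulVec_vacuum_holds (ι := Orb Λ)
    simp only [bondPair, sub_mulVec, ← mulVec_mulVec, hv (orb q 1), hv (orb q 0), mulVec_zero,
      sub_self]
  have h := groundEnergy_le_rayleigh_holds (dlsc_isHermitian_sourced G W t U μ) vacuum h1
  rw [sub_mulVec, dotProduct_sub, WcbcsBoxTiling.hamiltonianWith_mulVec_vacuum, dotProduct_zero,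
    dlsc_dotProduct_source_mulVec] at h
  simpa only [hB, dotProduct_zero, star_zero, add_zero, mul_zero, Finset.sum_const_zero, sub_zero,
    Complex.zero_re] using h

/-- Lower bounds on the Rayleigh quotient pass to the ground energy (variational principle,
`minEnergyOn_top`). [folklore] -/
theorem dlsb_le_groundEnergy_of_forall {n : Type*} [Fintype n] [DecidableEq n] [Nonempty n]
    {A : Matrix n n ℂ} (hA : A.IsHermitian) {c : ℝ}
    (h : ∀ ψ : n → ℂ, star ψ ⬝ᵥ ψ = 1 → c ≤ (star ψ ⬝ᵥ A *ᵥ ψ).re) : c ≤ A.groundEnergy := by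
  rw [← minEnergyOn_top_holds hA, Matrix.minEnergyOn]
  obtain ⟨i₀⟩ := ‹Nonempty n›
  refine le_csInf ⟨_, Pi.single i₀ 1, Submodule.mem_top, by simp, rfl⟩ ?_
  rintro E ⟨ψ, -, hψ, rfl⟩
  exact h ψ hψ

omit [LinearOrder Λ] in
/-- On a graph of maximal degree `≤ Δ` there are at most `Δ|Λ|` ordered adjacent pairs. [folklore] -/
theorem dlsb_card_filter_adj_pair_le (G : SimpleGraph Λ) [DecidableRel G.Adj] {Δ : ℕ}
    (hΔ : ∀ x : Λ, #{y | G.Adj x y} ≤ Δ) :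
    #{pq : Λ × Λ | G.Adj pq.1 pq.2} ≤ Δ * Fintype.card Λ := by
  calc #{pq : Λ × Λ | G.Adj pq.1 pq.2} = ∑ pq : Λ × Λ, if G.Adj pq.1 pq.2 then 1 else 0 :=
        Finset.card_filter _ _
    _ = ∑ p : Λ, ∑ q : Λ, if G.Adj p q then 1 else 0 := Fintype.sum_prod_type _
    _ = ∑ p : Λ, #{q | G.Adj p q} := by simp only [Finset.card_filter]
    _ ≤ ∑ _p : Λ, Δ := Finset.sum_le_sum fun p _ => hΔ p
    _ = Δ * Fintype.card Λ := by rw [Finset.sum_const, Finset.card_univ, smul_eq_mul, mul_comm]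

/-- **Volume lower bound** for a pair-sourced Hubbard Hamiltonian on a graph of maximal degree
`≤ Δ` whose weight (`|W| ≤ w`) is supported on adjacent pairs:
`E₀ ≥ −((Δ+1)|Λ|(2|t|+|U|+2|μ|) + Δ|Λ|·4w)`. [folklore] -/
theorem dlsb_neg_le_groundEnergy_sourced (G : SimpleGraph Λ) [DecidableRel G.Adj] {Δ : ℕ}
    (hΔ : ∀ x : Λ, #{y | G.Adj x y} ≤ Δ) (W : Λ → Λ → ℝ) {w : ℝ} (hw0 : 0 ≤ w)
    (hw : ∀ p q, |W p q| ≤ w) (hsupp : ∀ p q, W p q ≠ 0 → G.Adj p q) (t U μ : ℝ) :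
    -(((Δ : ℝ) + 1) * Fintype.card Λ * (2 * |t| + |U| + 2 * |μ|) +
        (Δ : ℝ) * Fintype.card Λ * (w * 4)) ≤
      (hamiltonianWith G t U μ -
        ∑ p : Λ, ∑ q : Λ, ((W p q : ℝ) : ℂ) • (bondPair p q + (bondPair p q)ᴴ)).groundEnergy := by
  haveI : Nonempty (Finset (Orb Λ)) := ⟨∅⟩
  refine dlsb_le_groundEnergy_of_forall (dlsc_isHermitian_sourced G W t U μ) fun ψ hψ => ?_
  have hH := groundEnergy_le_rayleigh_holds (isHermitian_hamiltonianWith G t U μ) ψ hψ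
  have hlow := WcbcsBoxTiling.neg_le_gc_groundEnergy_of_degree_le G hΔ t U μ
  rw [sub_mulVec, dotProduct_sub, dlsc_dotProduct_source_mulVec, Complex.sub_re]
  have hS : ‖∑ p : Λ, ∑ q : Λ, ((W p q : ℝ) : ℂ) *
      (star ψ ⬝ᵥ (bondPair p q *ᵥ ψ) + star (star ψ ⬝ᵥ (bondPair p q *ᵥ ψ)))‖ ≤
      ((Δ * Fintype.card Λ : ℕ) : ℝ) * (w * 4) := by
    rw [← Fintype.sum_prod_type']
    refine dlsc_norm_sum_le_of_card_le _ (fun pq : Λ × Λ => G.Adj pq.1 pq.2) (fun pq h => ?_)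
      (by positivity) (fun pq _ => ?_) (dlsb_card_filter_adj_pair_le G hΔ)
    · exact hsupp _ _ fun h0 => h (by rw [h0, Complex.ofReal_zero, zero_mul])
    · exact (dlsc_norm_weight_mul_pairAmp_le hψ _ _ _).trans
        (mul_le_mul_of_nonneg_right (hw _ _) (by norm_num))
  have hre := Complex.re_le_norm (∑ p : Λ, ∑ q : Λ, ((W p q : ℝ) : ℂ) *
      (star ψ ⬝ᵥ (bondPair p q *ᵥ ψ) + star (star ψ ⬝ᵥ (bondPair p q *ᵥ ψ))))
  push_cast at hS
  linarith

/-! ### The `d`-wave pair weight of a coordinate map -/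

/-- A non-zero value of the `d_{x²-y²}` form factor is taken only on the four unit steps. [folklore] -/
theorem dlsb_eq_unitStep_of_dWaveFormFactor_ne_zero {e : Site 2} (h : dWaveFormFactor e ≠ 0) :
    e = Pi.single 0 1 ∨ e = -Pi.single 0 1 ∨ e = Pi.single 1 1 ∨ e = -Pi.single 1 1 := by
  unfold dWaveFormFactor at h
  split_ifs at h with h1 h2
  · rcases h1 with h1 | h1
    · exact Or.inl h1
    · exact Or.inr (Or.inl h1)
  · rcases h2 with h2 | h2
    · exact Or.inr (Or.inr (Or.inl h2))
    · exact Or.inr (Or.inr (Or.inr h2))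
  · exact absurd rfl h

/-- Two points of `ℤ²` differing by a unit step are adjacent in `zdGraph 2`. [folklore] -/
theorem dlsb_zdGraph_adj_of_sub {a b : Site 2}
    (h : b - a = Pi.single 0 1 ∨ b - a = -Pi.single 0 1 ∨ b - a = Pi.single 1 1 ∨
      b - a = -Pi.single 1 1) : (zdGraph 2).Adj a b := by
  rw [zdGraph_adj_iff]
  rcases h with h | h | h | h
  · exact ⟨0, Or.inl (by rw [← h]; abel)⟩
  · refine ⟨0, Or.inr ?_⟩
    rw [sub_eq_iff_eq_add'] at h
    rw [h]; abel
  · exact ⟨1, Or.inl (by rw [← h]; abel)⟩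
  · refine ⟨1, Or.inr ?_⟩
    rw [sub_eq_iff_eq_add'] at h
    rw [h]; abel

omit [LinearOrder Λ] [Fintype Λ] in
/-- **The `d`-wave weight of a coordinate map**: for `ι : Λ → ℤ²` the weight
`W(p,q) = h · d(ι q − ι p)/√2` is bounded by `|h|`. [folklore] -/
theorem dlsb_abs_coordWeight_le (ι : Λ → Site 2) (h : ℝ) (p q : Λ) :
    |h * (dWaveFormFactor (ι q - ι p) / Real.sqrt 2)| ≤ |h| := by
  rw [abs_mul]
  refine mul_le_of_le_one_right (abs_nonneg h) ?_
  rw [abs_div, abs_of_pos (Real.sqrt_pos.2 (by norm_num : (0 : ℝ) < 2))]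
  have h2 : (1 : ℝ) ≤ Real.sqrt 2 := Real.one_le_sqrt.2 (by norm_num)
  calc |dWaveFormFactor (ι q - ι p)| / Real.sqrt 2 ≤ 1 / Real.sqrt 2 :=
        div_le_div_of_nonneg_right (abs_dWaveFormFactor_le_one _) (by positivity)
    _ ≤ 1 := by rw [div_le_one (by positivity)]; exact h2

omit [LinearOrder Λ] [Fintype Λ] in
/-- The `d`-wave weight of a coordinate map is supported on pairs adjacent in the pulled-back
nearest-neighbour graph. [folklore] -/
theorem dlsb_comap_adj_of_coordWeight_ne_zero (ι : Λ → Site 2) (h : ℝ) (p q : Λ)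
    (hne : h * (dWaveFormFactor (ι q - ι p) / Real.sqrt 2) ≠ 0) :
    ((zdGraph 2).comap ι).Adj p q := by
  rw [SimpleGraph.comap_adj]
  refine dlsb_zdGraph_adj_of_sub (dlsb_eq_unitStep_of_dWaveFormFactor_ne_zero fun h0 => hne ?_)
  rw [h0, zero_div, mul_zero]


end GenericBoxes


end Summit.HubbardSuperconductivity.HubbardSuperconductivity.Theorems

end
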